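import Summits.QuantumFields.YangMills.Theorems.BalabanUVNodesN15TwoSpacingGluingCommutator
import Summits.QuantumFields.YangMills.Theorems.BalabanUVNodesN15FullPropagatorEntry2Rows
import Summits.QuantumFields.YangMills.Theorems.BalabanUVNodesN15TwoGridEntry0
import HarnessLib

/-!
# THE GLUING STEP AT TWO LATTICE SPACINGS, XVII: the BRIDGE from dag-n15-a's symbol calculus to this lineage's Leibniz vocabulary — `ρ(sLapDir_ν) = lapDir n (bshiftEquiv ν)`,
# `ρ(sLap) = Σ_ν lapDir n (bshiftEquiv ν)`, hence Bałaban's Landau-gauge `Δ_a = Δ − ∂P∂* + aQ*Q` (`TwoGrid.deltaOp`) IS `lapOp n bshiftEquiv (a·Q*Q) + (−landauRe)` — the `Δ_loc + N` form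
# FILE 57 `hasMaj_commOp_comp_of_add` consumes, with FILE 46's two-sided local row and dag-n15-a's `hasMaj_landauRe` through FILE 56 (dag-n15-c g11, FILE 62; WANT-n15-c (i) of
# dag-n15-a g19 l.28442; N15 = NE2, s1 «background-layer OPERATOR ingredient»)

Cell `pub-ymgap`, seat `pub-ymgap-dag-n15-c` (R134 (a); HUMAN RULING D-0062), generation 11.  `bears_on: R4∕N15 · K3⁷ SpineGivenEndpointR13SepCoPH (stmt-QuantumFields-20544)`.
Filed `--supports stmt-QuantumFields-20544 --as helper` — COUNT-NEUTRAL.  Theorems only (0 `def`, 0 `sorry`).  Imports BY NAME FILE 46 `…N15TwoSpacingGluingCommutator` (`lapDir`, `lapOp`), n15-b∕g10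
`…N15FullPropagatorEntry2Rows` (`symbOp_sD_eq`, `bshiftEquiv`) and dag-n15-a's `…N15TwoGridEntry0` (`deltaOp_eq`, `landauRe`, `sLap`, `sLapDir`, `sTinv`, `qvRe`, `qvAdjRe`); nothing modified.

WHY.  dag-n15-a g19 (l.28442): «WANT-n15-c: YES — please take (i) the bridge `symbOp (sLap n) = Σ_μ lapDir n (e μ)` on the bond carrier and (ii) the assembly in your `commOp`∕`lapDir`
vocabulary».  THIS FILE is (i): ★ `symbOp_sLapDir_eq` — `ρ(−s_ν⁻¹(n(s_ν − 1))²) = ∇*_ν∇_ν = lapDir n (bshiftEquiv ν)` (pointwise: both are `f ↦ n²(2f − f(·+e_ν) − f(·−e_ν))`); ★★ `symbOp_sLap_eq`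
— `ρ(sLap n) = Σ_ν lapDir n (bshiftEquiv ν)`; ★★ `deltaOp_eq_lapOp_add` — `deltaOp M n a = lapOp n (bshiftEquiv M n) (a • (Q*∘Q)) + (−landauRe M n)` (dag-n15-a `deltaOp_eq`), i.e. FILE 57's
`Δ_loc := lapOp …` (FILE 46 `hasMaj_commOp_lapOp_comp` supplies its two-sided row at `W := a • Q*Q`, whose `hW` is FILE 51 `hasMaj_commOp_blockLocal_comp`) and `N := −landauRe` (FILE 56
`hasMaj_commOp_nonlocal` fed by dag-n15-a `hasMaj_landauRe` + `HasMaj.neg`).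

HONEST FRAMING ∕ LIMITS.  Three identities of lattice algebra; [B5] (1.21) p.21, (1.69) p.29 = SHAPES; nothing of [B5]∕[B6]∕[B9] asserted; the assembly (ii) is the sequel.  NE2⁺ NOT PRINTED,
NOT proved; N15 NOT discharged; counts of record UNMOVED (typed 28∕28 · discharged 5∕27); one finite 𝕋⁴ at fixed ε — NOT infinite volume, NOT OS on ℝ⁴, NOT a mass gap, NOT Clay; R4
closes the conditional finite-𝕋⁴ rung `BalabanLadder.UV` only.  Restate-immune (no Theses import).
-/

noncomputable section

namespace Summit.QuantumFields.YangMills.BalabanUVNodes.N15.Gluing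

open Literature.MathematicalPhysics.QuantumFieldTheory.Balaban1983to89
open Literature.MathematicalPhysics.QuantumFieldTheory.Balaban1983to89.B5Prop11Plancherel (Tor fine unitVec)
open Summit.QuantumFields.YangMills.BalabanUVNodes.N15.BackgroundLayer (fgrad fgradAdj fgrad_apply fgradAdj_apply symbOp_sD_eq)
open Summit.QuantumFields.YangMills.BalabanUVNodes.N15.VectorPiece (bshiftEquiv bshiftEquiv_apply bshiftEquiv_symm_apply)
open Summit.QuantumFields.YangMills.BalabanUVNodes.N15.TwoGrid (symbOp symbOp_single_apply sT sTinv sD sLapDir sLap deltaOp deltaOp_eq landauRe qvRe qvAdjRe)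

variable {d : ℕ} (M : Fin (d + 1) → ℕ) (n : ℕ)

/-- ★ **`ρ(sLapDir_ν n) = ∇*_ν∇_ν`**: dag-n15-a's directional Laplacian symbol `−s_ν⁻¹(n(s_ν − 1))²` acts as this lineage's `lapDir n (bshiftEquiv ν) = fgradAdj ∘ fgrad`.
[cite: Balaban1984PropagatorsI, (1.21) p.21 (Δ(p) = Σ|∂_μ(p)|²: shape)] -/
theorem symbOp_sLapDir_eq (ν : Fin (d + 1)) : symbOp M n (sLapDir M n ν (n : ℝ)) = lapDir (n : ℝ) (bshiftEquiv M n ν) := by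
  refine LinearMap.ext fun f => funext fun i => ?_
  rw [sLapDir, map_neg, sq, map_mul, map_mul, symbOp_sD_eq]
  simp only [LinearMap.neg_apply, Pi.neg_apply, Module.End.mul_apply, sTinv, symbOp_single_apply, one_mul, lapDir, LinearMap.comp_apply, fgradAdj_apply, fgrad_apply,
    bshiftEquiv_apply, bshiftEquiv_symm_apply, sub_add_cancel, Prod.mk.eta, ← sub_eq_add_neg]
  ring

/-- ★★ **`ρ(sLap n) = Σ_ν ∇*_ν∇_ν`**. [cite: Balaban1984PropagatorsI, (1.21) p.21] -/
theorem symbOp_sLap_eq : symbOp M n (sLap M n (n : ℝ)) = ∑ ν, lapDir (n : ℝ) (bshiftEquiv M n ν) := by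
  rw [sLap, map_sum]
  exact Finset.sum_congr rfl fun ν _ => symbOp_sLapDir_eq M n ν

variable [∀ μ, NeZero (M μ)] [NeZero n]

/-- ★★ **BAŁABAN's `Δ_a` IN THE `Δ_loc + N` FORM**: `deltaOp M n a = lapOp n (bshiftEquiv M n) (a • (Q*∘Q)) + (−∂Π∂*)` — FILE 57's local part (FILE 46's rows at `W := a • Q*Q`) plus the nonlocal
Landau tail (FILE 56's `N`, letter = dag-n15-a `hasMaj_landauRe`). [cite: Balaban1984PropagatorsI, (1.69) p.29 (Δ_a = Δ − ∂P∂* + aQ*Q)] -/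
theorem deltaOp_eq_lapOp_add (a : ℝ) :
    deltaOp M n a = lapOp (n : ℝ) (bshiftEquiv M n) (a • (qvAdjRe M n ∘ₗ qvRe M n)) + (-landauRe M n) := by
  rw [deltaOp_eq, symbOp_sLap_eq, lapOp]
  abel

end Summit.QuantumFields.YangMills.BalabanUVNodes.N15.Gluing

end
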